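/-
Copyright: statement-level skeleton of a published paper (lit-balaban cell, Phase-2 proof seat p25, gen 18). No proof
claims beyond what the kernel checks below.
-/
import Literature.MathematicalPhysics.QuantumFieldTheory.BalabanImbrieJaffe1984to88.BIJ88WalkLocalCount312
import Literature.MathematicalPhysics.QuantumFieldTheory.BalabanImbrieJaffe1984to88.BIJ88WalkActivityShape312

/-!
# `BalabanImbrieJaffe1984to88.BIJ88WalkBlockActivity312` — T. Bałaban, J. Imbrie, A. Jaffe, *Effective action and cluster
properties of the abelian Higgs model*, Commun. Math. Phys. **114** (1988) 257–315 [BalabanImbrieJaffe1988], §5.14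
p. 311–312 [PDF 55–56], verbatim: *"The other components are called constant components {X_c}, since the observable
there is independent of A^{(k)}, φ^{(k)}. We can arrange the construction so that the {X_c} are determined once the
remainder components are specified. Summing all possible diagrams in X_c gives the observable for the next step
there, F^L_{k+1,loc}(X_c)."* (DOCFIX v1.3, r16 gen 26 as C2 §5 owner on referee ref-1's F1 ask, gens 80–88: v1.0–v1.2
had «gives the constant observable F^L_{k+1,loc}(X_c)» inside the quotation marks and elided the middle sentence
without a marker; print `p0056.txt` L2–4 re-read 2026-08-23; declarations untouched), p. 312 verbatim: *"The main
source of concern in estimating G_k(X_{r′}) is that we only have bounds |F_{k,loc}(X_{σ₁})| ≤ c(L^kε)^{−m(c)}e^{−m′(c)}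
coming from our estimates on perturbation expansions of observables; similarly for F^L_{k+1,loc}(X_c)."*, *"By
performing sufficiently many integrations by parts, we have arranged for enough small factors to beat these large
factors in the remainder terms (at least if X_{r′} is not at the boundary of Λ₁₂^{(k)})."*, p. 309 verbatim (the small factor of the expansion (5.14.3)–(5.14.4)): *"Each factor
V^{(k)}(Y) in Π_{j∈H_β}(d/dt)_{γ_j} produces a factor e^β(L^kε/ε₀)^{1/4−α} in the final estimate."*, and the p. 312
estimate *"|G_k(X)| ≤ c(F(X))(e^β(L^kε/ε₀)^{1/4−α})^{β′|X∖∪X_c|} Π [c(L^kε)^{−m}e^{−m′}]"* (DOCFIX p25 gen 19, ref-5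
D-g64-2: the gen-18 header paraphrased two of these sentences inside quotation marks; the printed sentences are
restored, declarations untouched; v1.2 p25 gen 19: «V^{(k)}(Y)», «Π_{j∈H_β}», «Λ₁₂^{(k)}», «; similarly for F^L_{k+1,loc}»
read off the x2 renders `lit-balaban-r16/renders/cmp114/original-p053-x2.png` / `…-p056-x2.png` — the text layer
drops these sub/superscripts — declarations untouched)
— **THE CONSTANT-COMPONENT ACTIVITY LOCALIZED AT A CUBE SET `X`, BOUNDED IN THE PRINTED CURRENCY** (p25 gen 18): for
the observable `i` run in the environment `B` (the connected constant diagrams on `{i} ∪ B`), the sum of the weights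
of its CONSTANT outcomes whose cubes (observable cubes ∪ vertex cubes ∪ walk regions) are exactly `X` is at most
`W^Φ · (Π_{j ∈ {i}∪B} B_ℓ^{|obs j|}) · θ^{#(X ∖ observable cubes)}`:
a LARGE constant per observable (`B_ℓ^{|obs j|}`, print's `c(L^kε)^{−m(c)}e^{−m′(c)}`), a SMALL factor per cube of
`X` not covered by the observables (print's `(…)^{β′|X∖∪X_c|}`), and a COMBINATORIAL constant `W^Φ` depending on
the fixed family of observables only (print's `c(F(X))`) — by the weight invariant (`BIJ88WalkWeights312`), the
printed currency (`BIJ88WalkActivityShape312`) and the LOCAL count of the nondegenerate outcomes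
(`BIJ88WalkLocalCount312`), uniformly in the number of covariance pieces and of vertices.

statement-level skeleton of published theorems with citation tags; proofs where landed; nothing here is a claim
about the Yang–Mills mass gap

PDF held: `paper:balaban1988-cmp114-bij-abelian-higgs-effective-action` (journal page = PDF page + 256); p. 311–312 =
PDF 55–56 (`p0055.txt` L23–38, `p0056.txt` L1–25 re-read 2026-08-22; `p0056.txt` L20–25 and `p0053.txt` L16–17 re-read
for the docfix, 2026-08-23).

CITATION HEADER (lean-in-tree rule).  lit-balaban cell (HOME `run/shared/lean/pub/lit-balaban/`), Phase 2, seat p25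
gen 18; row **C2.Claim@312** of `HOME/lit-balaban-r16/ROWS-C2-part2.md` (owner r16, referee ref-5; head
`BIJ88Sect5StatementsPart4.Ineq312` untouched — this file is a MEMBER of the row: the block factor of the printed
estimate, not the estimate).  USED BY NAME, nothing restated: `BIJ88WalkRun311.{run, pristine, WGrp.IsConst}`,
`BIJ88WalkRunEnv311.{run_const, run_pcs_eq, run_lab}`, `BIJ88WalkGeometry311.{cubes, Nondeg}`,
`BIJ88WalkWeights312.{wt, tsize, run_weight, Tidy, run_tidy, tidy_pristine, LabDisj}`,
`BIJ88WalkActivityShape312.{shape, wt_le_shape}`, `BIJ88WalkLocalCount312.run_lsum_pristine_le` (this seat and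
generation), `BIJ88VertexComponents311.maxArity`.

## What is proved (0 `sorry`, standard axioms, no new `Prop` facts; definitions with bodies: `flAt`, `flAbsAt`)

* §1 `flAt` (the constant-component activity of `(i, B)` localized at `X`: the sum of the weights of the constant
  outcomes with all of `B` absorbed and cubes exactly `X` — the `X`-part of `BIJ88WalkResummation312.fl i B`),
  `flAbsAt` (the same with absolute values), `abs_flAt_le`.
* §2 **`flAbsAt_le`**: THE BOUND IN THE PRINTED CURRENCY, for brackets `|⟨C_p u, w⟩| ≤ B′_p·ρ_p` split into an
  activity part `B′` (`≤ B_ℓ` on local pieces, `≤ θ^{#reg p}` on walk pieces) and a counting part `ρ`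
  (`Σ_{p : C_p u ≠ 0} ρ p ≤ ρ₀`), vertices with `cV m·B_ℓ^{|legs m|} ≤ θ^{#vc m}` and at most `N₀` (vertex, leg) pairs
  coupled to one `C_p u`, `W ≥ 1`, `ρ₀·(Φ + N₀) ≤ W`, `Φ = |obs i| + 1 + M·maxArity + Σ_{j∈B}|obs j|`.
HONEST SCOPE: (a) the CONSTANT components only (print's `F^L_{k+1,loc}(X_c)`; the remainder components `X_r` carry
the Gaussian integral of their pending structure — `BIJ88WalkIdentity311.tval` — whose estimate is not made here);
(b) locality and the convergence of the random-walk expansion are HYPOTHESES in abstract form (`ρ₀`, `N₀`, `B′`, `ρ`);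
(c) the combinatorial constant is `W^Φ`, not print's; (d) contraction-graph components (cubes = observable cubes ∪
vertex cubes ∪ walk regions of the pieces used); (e) no `Ineq312` binder — the head is typed at print's ceiling and
stays untouched.  NOT summit progress; NOT continuum; NOT Clay.  Imports `BIJ88WalkLocalCount312`,
`BIJ88WalkActivityShape312`; modifies nothing.
-/

noncomputable section

namespace Literature.MathematicalPhysics.QuantumFieldTheory.BalabanImbrieJaffe1984to88.BIJ88WalkBlockActivity312

open Classical Matrix Finset
open scoped BigOperators
open BIJ88VertexComponents311 (maxArity)
open BIJ88WalkRun311 BIJ88WalkRunEnv311 BIJ88WalkGeometry311 BIJ88WalkWeights312 BIJ88WalkActivityShape312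
  BIJ88WalkLocalCount312

variable {S : Type} [Fintype S] {ι : Type} [Fintype ι] {κ : Type} [LinearOrder κ] {P : Type} [Fintype P]
  {β : Type} [DecidableEq β]

/-! ## §1  The constant-component activity localized at a cube set -/

section Defs

variable (Cov : P → Matrix S S ℝ) (trig : P → Bool) (f : S → ℝ) (c : ι → ℝ) (legs : ι → List (S → ℝ))
  (obs : κ → List (S → ℝ)) (M : ℕ) (oc : κ → Finset β) (vc : ι → Finset β) (reg : P → Finset β)

/-- **The constant-component activity of `(i, B)` localized at `X`** (*"Summing all possible diagrams in X_c gives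
the observable for the next step there, F^L_{k+1,loc}(X_c)."*, the diagrams with cubes exactly `X`): the sum of the
weights of the outcomes of the run of the pristine observable `i` in the environment `B` that end CONSTANT, have
absorbed all of `B`, and whose cubes are `X`. [cite: BalabanImbrieJaffe1988, §5.14 p.312] -/
def flAt (i : κ) (B : Finset κ) (X : Finset β) : ℝ :=
  ((run Cov trig f c legs obs M (pristine obs i) B 0).map fun o =>
    if o.g.IsConst M ∧ o.rest = ∅ ∧ cubes oc vc reg o.g = X then o.a else 0).sum

/-- The same with absolute values (the quantity that is estimated). [cite: BalabanImbrieJaffe1988, §5.14 p.312] -/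
def flAbsAt (i : κ) (B : Finset κ) (X : Finset β) : ℝ :=
  ((run Cov trig f c legs obs M (pristine obs i) B 0).map fun o =>
    if o.g.IsConst M ∧ o.rest = ∅ ∧ cubes oc vc reg o.g = X then |o.a| else 0).sum

variable {Cov trig f c legs obs M oc vc reg}

/-- `|flAt i B X| ≤ flAbsAt i B X` (bookkeeping). [cite: BalabanImbrieJaffe1988, §5.14 p.312] -/
theorem abs_flAt_le (i : κ) (B : Finset κ) (X : Finset β) :
    |flAt Cov trig f c legs obs M oc vc reg i B X| ≤ flAbsAt Cov trig f c legs obs M oc vc reg i B X := by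
  refine Multiset.abs_sum_le_sum_abs.trans (le_of_eq ?_)
  rw [flAbsAt, Multiset.map_map]
  refine congrArg _ (Multiset.map_congr rfl fun o _ => ?_)
  simp only [Function.comp_apply]
  split_ifs
  · rfl
  · exact abs_zero

end Defs

/-! ## §2  The bound in the printed currency -/

section Bound

variable {Cov : P → Matrix S S ℝ} {trig : P → Bool} {f : S → ℝ} {c : ι → ℝ} {legs : ι → List (S → ℝ)}
  {obs : κ → List (S → ℝ)} {M : ℕ} {oc : κ → Finset β} {vc : ι → Finset β} {reg : P → Finset β}

/-- **THE CONSTANT-COMPONENT ACTIVITY AT `X` IN THE PRINTED CURRENCY**: observables and vertex legs with directions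
in `Dir`; brackets of the piece `p` bounded by `B′_p·ρ_p` (`|⟨C_p u, w⟩|`, `|⟨C_p u, f⟩|`, `‖C_p u‖` for
`u, w ∈ Dir`) with `B′_p ≤ B_ℓ`, no region, on the local pieces and `B′_p ≤ θ^{#reg p}` on the walk pieces
(`B_ℓ ≥ 1`, `0 < θ ≤ 1`), `ρ ≥ 0` with `Σ_{p : C_p u ≠ 0} ρ p ≤ ρ₀`; couplings `|c m| ≤ cV m` with
`cV m·B_ℓ^{|legs m|} ≤ θ^{#vc m}` and at most `N₀` (vertex, leg) pairs coupled to one `C_p u`; `i ∉ B`, `W ≥ 1`,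
`ρ₀·(Φ + N₀) ≤ W`.  Then for every cube set `X`,
`flAbsAt i B X ≤ W^Φ · (Π_{j ∈ {i}∪B} B_ℓ^{|obs j|}) · θ^{#(X ∖ ⋃_{j∈{i}∪B} oc j)}`.
[cite: BalabanImbrieJaffe1988, §5.14 p.312] -/
theorem flAbsAt_le {Dir : Set (S → ℝ)} {B' ρ : P → ℝ} {cV : ι → ℝ} {Bl θ ρ₀ W : ℝ} {N₀ : ℕ}
    (hθ0 : 0 < θ) (hθ1 : θ ≤ 1) (hBl : 1 ≤ Bl) (hB0 : ∀ p, 0 ≤ B' p) (hρ : ∀ p, 0 ≤ ρ p) (hcV0 : ∀ m, 0 ≤ cV m)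
    (hB : ∀ p, ∀ u ∈ Dir, ∀ w ∈ Dir, |(Cov p *ᵥ u) ⬝ᵥ w| ≤ B' p * ρ p)
    (hBf : ∀ p, ∀ u ∈ Dir, |(Cov p *ᵥ u) ⬝ᵥ f| ≤ B' p * ρ p) (hBz : ∀ p, ∀ u ∈ Dir, ‖Cov p *ᵥ u‖ ≤ B' p * ρ p)
    (hcV : ∀ m, |c m| ≤ cV m) (hobs : ∀ j, ∀ w ∈ obs j, w ∈ Dir) (hlegs : ∀ m, ∀ w ∈ legs m, w ∈ Dir)
    (hloc : ∀ p, trig p = false → B' p ≤ Bl ∧ reg p = ∅) (hwalk : ∀ p, trig p = true → B' p ≤ θ ^ (reg p).card)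
    (hvert : ∀ m, cV m * Bl ^ (legs m).length ≤ θ ^ (vc m).card)
    (hρ₀ : ∀ u ∈ Dir, (∑ p ∈ univ.filter (fun p => Cov p *ᵥ u ≠ 0), ρ p) ≤ ρ₀)
    (hN : ∀ p, ∀ u ∈ Dir,
      (∑ m, ((range (legs m).length).filter fun j => (Cov p *ᵥ u) ⬝ᵥ (legs m).getD j 0 ≠ 0).card) ≤ N₀)
    {i : κ} {B : Finset κ} (hi : i ∉ B) (hW1 : 1 ≤ W)
    (hW : ρ₀ * (((obs i).length + 1 + M * maxArity legs + ∑ j ∈ B, (obs j).length + N₀ : ℕ) : ℝ) ≤ W)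
    (X : Finset β) :
    flAbsAt Cov trig f c legs obs M oc vc reg i B X
      ≤ W ^ ((obs i).length + 1 + M * maxArity legs + ∑ j ∈ B, (obs j).length)
        * ((∏ j ∈ insert i B, Bl ^ (obs j).length) * θ ^ (X \ (insert i B).biUnion oc).card) := by
  obtain ⟨shX, hshX⟩ : ∃ s : ℝ, s = (∏ j ∈ insert i B, Bl ^ (obs j).length) * θ ^ (X \ (insert i B).biUnion oc).card :=
    ⟨_, rfl⟩
  rw [← hshX]
  have hshX0 : 0 ≤ shX :=
    hshX ▸ mul_nonneg (prod_nonneg fun j _ => pow_nonneg (zero_le_one.trans hBl) _) (pow_nonneg hθ0.le _)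
  have hBρ0 : ∀ p, 0 ≤ B' p * ρ p := fun p => mul_nonneg (hB0 p) (hρ p)
  have hprod0 : ∀ o : WOut S κ ι P, 0 ≤ (o.dp.map ρ).prod := fun o =>
    Multiset.prod_nonneg fun x hx => by obtain ⟨p, -, rfl⟩ := Multiset.mem_map.1 hx; exact hρ p
  have hd0 : ∀ h ∈ (0 : Multiset (WGrp S κ ι P)), ∀ w ∈ h.pend, w ∈ Dir := fun h hh => absurd hh (Multiset.notMem_zero _)
  have hLD : LabDisj (pristine (ι := ι) (P := P) obs i) B 0 :=
    ⟨Finset.disjoint_singleton_left.2 hi, fun h hh => absurd hh (Multiset.notMem_zero _),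
      fun h hh => absurd hh (Multiset.notMem_zero _)⟩
  have hwt1 : wt (fun p => B' p * ρ p) cV (pristine (ι := ι) (P := P) obs i) = 1 := by simp [wt, pristine]
  -- pointwise: a constant outcome at `X` is bounded by `shX` times its counting weight
  have hpt : ∀ o ∈ run Cov trig f c legs obs M (pristine obs i) B 0,
      (if o.g.IsConst M ∧ o.rest = ∅ ∧ cubes oc vc reg o.g = X then |o.a| else 0)
        ≤ shX * (if Nondeg o then (o.dp.map ρ).prod else 0) := by
    intro o ho
    by_cases hcl : o.g.IsConst M ∧ o.rest = ∅ ∧ cubes oc vc reg o.g = X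
    swap
    · rw [if_neg hcl]
      refine mul_nonneg hshX0 ?_
      split_ifs
      · exact hprod0 o
      · exact le_rfl
    rw [if_pos hcl]
    obtain ⟨hconst, hrest, hX⟩ := hcl
    obtain ⟨hD, hdone, -⟩ := run_const _ _ _ o ho (fun h hh => absurd hh (Multiset.notMem_zero _)) hconst
    by_cases hnd : Nondeg o
    swap
    · -- a degenerate constant outcome has weight zero (it has no `χ′`-direction)
      have ha : o.a = 0 := by
        by_contra ha
        exact hnd ⟨ha, fun z hz => by rw [hD] at hz; exact absurd hz List.not_mem_nil⟩
      rw [if_neg hnd, ha, abs_zero, mul_zero]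
    rw [if_pos hnd]
    -- the weight invariant with the bracket bound `B′·ρ`
    have hw := run_weight (Cov := Cov) (trig := trig) (f := f) (c := c) (legs := legs) (obs := obs) (M := M)
      (B := fun p => B' p * ρ p) hBρ0 hcV0 hB hBf hBz hcV hobs hlegs (pristine obs i) B 0 o ho
      (fun w hw => hobs i w hw) hd0
    simp only [hwt1, hdone, Multiset.map_zero, Multiset.prod_zero, mul_one] at hw
    have hts : tsize o = |o.a| := by simp [tsize, hD]
    -- the activity part and the counting part of the weight
    have hsplit : wt (fun p => B' p * ρ p) cV o.g = wt B' cV o.g * (o.g.pcs.map ρ).prod := by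
      simp only [wt, Multiset.prod_map_mul]; ring
    have hpcs : o.g.pcs = o.dp := by
      simpa [hdone, pristine] using run_pcs_eq _ _ _ o ho
    -- the activity part in the printed currency
    have hT : Tidy obs legs o.g := (run_tidy _ _ _ o ho hLD (tidy_pristine i) fun h hh =>
      absurd hh (Multiset.notMem_zero _)).1
    have hle : wt B' cV o.g ≤ shape obs oc vc reg Bl θ o.g := wt_le_shape hθ0 hθ1 hBl hB0 hcV0 hloc hwalk hvert o.g hT
    have hlab : o.g.lab = insert i B := by
      have h := run_lab _ _ _ o ho
      rw [hdone, hrest] at h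
      simp only [pristine, Multiset.map_zero, Multiset.sup_zero, Finset.bot_eq_empty, Finset.union_empty] at h
      rw [h, Finset.insert_eq]
    have hshape : shape obs oc vc reg Bl θ o.g = shX := by
      rw [hshX, shape, hX, hlab]
    calc |o.a| = tsize o := hts.symm
      _ ≤ wt (fun p => B' p * ρ p) cV o.g := hw
      _ = wt B' cV o.g * (o.dp.map ρ).prod := by rw [hsplit, hpcs]
      _ ≤ shX * (o.dp.map ρ).prod := mul_le_mul_of_nonneg_right (hle.trans_eq hshape) (hprod0 o)
  -- summing, with the local count of the nondegenerate outcomes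
  calc flAbsAt Cov trig f c legs obs M oc vc reg i B X
      ≤ ((run Cov trig f c legs obs M (pristine obs i) B 0).map fun o =>
          shX * (if Nondeg o then (o.dp.map ρ).prod else 0)).sum := Multiset.sum_map_le_sum_map _ _ hpt
    _ = shX * ((run Cov trig f c legs obs M (pristine obs i) B 0).map fun o =>
          if Nondeg o then (o.dp.map ρ).prod else 0).sum := by rw [Multiset.sum_map_mul_left]
    _ ≤ shX * W ^ ((obs i).length + 1 + M * maxArity legs + ∑ j ∈ B, (obs j).length) :=
        mul_le_mul_of_nonneg_left (run_lsum_pristine_le (trig := trig) (f := f) (c := c)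
          hobs hlegs hρ hρ₀ hN i B hW1 hW) hshX0
    _ = _ := mul_comm _ _

end Bound

end Literature.MathematicalPhysics.QuantumFieldTheory.BalabanImbrieJaffe1984to88.BIJ88WalkBlockActivity312

end
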